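import Literature.Probability.LatticeModels.StarLatticeBox
import HarnessLib

/-!
# Lemma B.81 for a RETRACT of `ℤ^{d★}`: the `★`-triangles of `V` generate the cycle space of the `★`-graph induced on `V`

builds on p205010 (kernel theorem, internal audit signed; external expert review pending) — NOT used in this file.
Lane `prim-bschramm`, seat `prim-bschramm-p2` (gen 25; class C1b; memo `HOME/bschramm/P2-LATTICES.md` §90, the HORN PROGRAMME);
helper file (`--supports stmt-CriticalPhenomena-4575 --as helper`).

THE POINT.  Contour (Peierls) arguments INSIDE A SUB-REGION `V ⊆ ℤ^d` — a truncated horn, a staircase region, a union of boxes — need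
Friedli–Velenik's Lemma B.82 for the `★`-graph induced on `V`, whose input (via Lemma B.83 = `exists_generator_crossing_both_rel`) is
Lemma B.81 for `V`: every even set of `★`-edges with endpoints in `V` is a sum modulo 2 of `★`-triangles WITH ALL VERTICES IN `V`.
`StarLatticeBox.lean` proves this for coordinate boxes by pushing a triangle decomposition forward along the coordinatewise clamp.  The
proof uses only that the clamp is a RETRACTION of `ℤ^d` onto the box which is `1`-Lipschitz for `‖·‖_∞`; here it is typed for an
arbitrary such retraction `π : ℤ^d → V` (`π(ℤ^d) ⊆ V`, `π|_V = id`, `d_∞(πx, πy) ≤ d_∞(x, y)`):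
**`inSpan_starTriangles_of_retract`**, with the side conditions of Lemma B.83 for the `V`-family (`starTriangles_sub_even_edge`) and the
generation hypothesis in the exact shape `exists_generator_crossing_both_rel` consumes (`gen_of_retract`).
Regions with a `1`-Lipschitz retraction include every coordinate box, every "monotone staircase" region
`{z | a ≤ z₁ ≤ b, 0 ≤ z₀ ≤ F(z₁), 0 ≤ z₂ ≤ F(z₁)}` with `|F(s+1) − F(s)| ≤ 1` (file `StarRetractRegions`), and products of such.
The `𝔽₂`-pushforward helpers are re-typed here (they are private in `StarLatticeBox.lean`).
[cite: FriedliVelenik2017, App. B.15, Lemma B.81] [cite: Timar2013, Theorem 3]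
-/

open Finset SimpleGraph
open Literature.Combinatorics.SimpleGraph.CycleSpace Literature.Probability.LatticeModels

namespace Summit.CriticalPhenomena.PercolationContinuityZ3.Theorems.Transplant

namespace StarRetract

/-! ## §1 The `𝔽₂`-pushforward of a finite edge set along an edge map -/

section Push

variable {ι γ : Type*} [DecidableEq ι] [DecidableEq γ]

/-- **Additivity of the `𝔽₂`-pushforward** `Z ↦ ∆_{e ∈ Z} f e`. [folklore] -/
theorem fold_symmDiff_symmDiff (f : ι → Finset γ) (s t : Finset ι) :
    Finset.fold symmDiff ∅ f (symmDiff s t) =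
      symmDiff (Finset.fold symmDiff ∅ f s) (Finset.fold symmDiff ∅ f t) := by
  have hdisj : Disjoint (symmDiff s t) (s ∩ t) := by
    rw [Finset.disjoint_left]
    intro e he hst
    rw [Finset.mem_symmDiff] at he
    rw [Finset.mem_inter] at hst
    tauto
  have hunion : s ∪ t = (symmDiff s t).disjUnion (s ∩ t) hdisj := by
    ext e
    simp only [Finset.mem_union, Finset.disjUnion_eq_union, Finset.mem_symmDiff, Finset.mem_inter]
    tauto
  have h1 := Finset.fold_union_inter (op := symmDiff) (f := f) (s₁ := s) (s₂ := t)
    (b₁ := (∅ : Finset γ)) (b₂ := (∅ : Finset γ))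
  have h3 := Finset.fold_disjUnion (op := symmDiff) (f := f) (b₁ := (∅ : Finset γ)) (b₂ := (∅ : Finset γ)) hdisj
  rw [symmDiff_self, Finset.bot_eq_empty] at h3
  have h2 : Finset.fold symmDiff (∅ : Finset γ) f (s ∪ t) =
      symmDiff (Finset.fold symmDiff ∅ f (symmDiff s t)) (Finset.fold symmDiff ∅ f (s ∩ t)) := by
    rw [hunion]; exact h3
  rw [h2, symmDiff_assoc, symmDiff_self, symmDiff_bot] at h1
  exact h1

/-- **Pushing a span forward**: if every generator of `𝒞` is mapped to a member of `𝒟` or to zero, the pushforward of a set in the span of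
`𝒞` lies in the span of `𝒟`. [folklore] -/
theorem inSpan_fold_symmDiff {α' β' : Type*} [DecidableEq α'] [DecidableEq β']
    {𝒞 : Set (Finset (Sym2 α'))} {𝒟 : Set (Finset (Sym2 β'))} (f : Sym2 α' → Finset (Sym2 β'))
    (hf : ∀ C ∈ 𝒞, Finset.fold symmDiff ∅ f C ∈ 𝒟 ∨ Finset.fold symmDiff ∅ f C = ∅)
    {Z : Finset (Sym2 α')} (hZ : InSpan 𝒞 Z) : InSpan 𝒟 (Finset.fold symmDiff ∅ f Z) := by
  induction hZ with
  | empty => rw [Finset.fold_empty]; exact InSpan.empty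
  | @step C Z' hC _ ih =>
    rw [fold_symmDiff_symmDiff]
    rcases hf C hC with h | h
    · exact InSpan.step h ih
    · rw [h, bot_eq_empty.symm, bot_symmDiff]; exact ih

/-- A set on which `f` is the embedding `e ↦ {e}` is its own pushforward. [folklore] -/
theorem fold_symmDiff_eq_self (f : ι → Finset ι) {Z : Finset ι} (hZ : ∀ e ∈ Z, f e = {e}) :
    Finset.fold symmDiff ∅ f Z = Z := by
  induction Z using Finset.induction_on with
  | empty => exact Finset.fold_empty
  | insert e s hes ih =>
    rw [Finset.fold_insert hes, hZ e (Finset.mem_insert_self e s),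
      ih fun e' he' => hZ e' (Finset.mem_insert_of_mem he')]
    rw [(Finset.disjoint_singleton_left.2 hes).symmDiff_eq_sup, sup_eq_union, insert_eq]

/-- **The image of a triangle** modulo 2: the triangle on `p q r` if they are pairwise distinct, zero otherwise. [folklore] -/
theorem symmDiff_pairs_three (p q r : γ) :
    symmDiff (if p = q then (∅ : Finset (Sym2 γ)) else {s(p, q)})
      (symmDiff (if q = r then (∅ : Finset (Sym2 γ)) else {s(q, r)})
        (if p = r then (∅ : Finset (Sym2 γ)) else {s(p, r)})) =
      if p ≠ q ∧ q ≠ r ∧ p ≠ r then {s(p, q), s(q, r), s(p, r)} else ∅ := by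
  have e1 : ∀ X : Finset (Sym2 γ), symmDiff ∅ X = X := fun X => by rw [← Finset.bot_eq_empty, bot_symmDiff]
  have e2 : ∀ X : Finset (Sym2 γ), symmDiff X ∅ = X := fun X => by rw [← Finset.bot_eq_empty, symmDiff_bot]
  by_cases hpq : p = q
  · subst hpq
    by_cases hpr : p = r
    · subst hpr
      simp
    · simp [hpr]
  by_cases hqr : q = r
  · subst hqr
    simp [hpq, e1]
  by_cases hpr : p = r
  · subst hpr
    have hsw : s(q, p) = s(p, q) := Sym2.eq_swap
    simp [hpq, hqr, e2, hsw]
  rw [if_neg hpq, if_neg hqr, if_neg hpr, if_pos ⟨hpq, hqr, hpr⟩]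
  have h1 : s(q, r) ≠ s(p, r) := by
    intro h
    rcases Sym2.eq_iff.1 h with ⟨h, -⟩ | ⟨h, -⟩
    · exact hpq h.symm
    · exact hqr h
  have h2 : s(p, q) ∉ ({s(q, r), s(p, r)} : Finset (Sym2 γ)) := by
    simp only [Finset.mem_insert, Finset.mem_singleton, not_or]
    refine ⟨fun h => ?_, fun h => ?_⟩
    · rcases Sym2.eq_iff.1 h with ⟨h, -⟩ | ⟨h, -⟩
      · exact hpq h
      · exact hpr h
    · rcases Sym2.eq_iff.1 h with ⟨-, h⟩ | ⟨h, -⟩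
      · exact hqr h
      · exact hpr h
  rw [(Finset.disjoint_singleton_left.2 (Finset.notMem_singleton.2 h1)).symmDiff_eq_sup, sup_eq_union,
    ← insert_eq, (Finset.disjoint_singleton_left.2 h2).symmDiff_eq_sup, sup_eq_union, ← insert_eq]

end Push

/-! ## §2 Lemma B.81 for the `★`-triangles of a `1`-Lipschitz retract -/

variable {d : ℕ}

/-- **Lemma B.81 (Friedli–Velenik), RETRACT family.** Let `π : ℤ^d → ℤ^d` map into `V`, fix `V` pointwise, and not increase the
sup-distance. Then every even set `Z` of `★`-edges with all endpoints in `V` is a sum modulo 2 of `★`-triangles with all three vertices in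
`V`: the `★`-triangles of `V` generate the cycle space of the `★`-graph induced on `V`.  Proof: `Z` is a sum of `★`-triangles of `ℤ^d`
(`generatesCycles_zdStar`); push the decomposition forward along `π` — modulo 2 a `★`-triangle `xyz` goes to the `★`-triangle `πx πy πz`
of `V` when these points are distinct (pairwise at sup-distance `≤ 1`) and to zero otherwise, while every edge of `Z` is fixed.
[cite: FriedliVelenik2017, App. B.15, Lemma B.81] [cite: Timar2013, Theorem 3] -/
theorem inSpan_starTriangles_of_retract {V : Set (Site d)} (π : Site d → Site d) (hπV : ∀ x, π x ∈ V)
    (hπid : ∀ x ∈ V, π x = x) (hπlip : ∀ x y, supDist (π x) (π y) ≤ supDist x y)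
    {Z : Finset (Sym2 (Site d))} (hedge : ∀ e ∈ Z, e ∈ (zdStar d).edgeSet) (heven : IsEvenEdgeSet Z)
    (hV : ∀ e ∈ Z, ∀ x ∈ e, x ∈ V) :
    InSpan {T | T ∈ starTriangles d ∧ ∀ e ∈ T, ∀ x ∈ e, x ∈ V} Z := by
  classical
  -- the pushforward along `π`
  set f : Sym2 (Site d) → Finset (Sym2 (Site d)) :=
    fun e => if (Sym2.map π e).IsDiag then ∅ else {Sym2.map π e} with hf
  have hfmk : ∀ x y : Site d, f s(x, y) = if π x = π y then ∅ else {s(π x, π y)} := by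
    intro x y
    simp only [hf, Sym2.map_mk, Sym2.mk_isDiag_iff]
  -- the image of a `★`-triangle is a triangle of `V` or zero
  have htri : ∀ C ∈ starTriangles d,
      Finset.fold symmDiff ∅ f C ∈ {T | T ∈ starTriangles d ∧ ∀ e ∈ T, ∀ x ∈ e, x ∈ V} ∨
        Finset.fold symmDiff ∅ f C = ∅ := by
    rintro C ⟨x, y, z, hxy, hyz, hxz, rfl⟩
    have hne1 : s(y, z) ≠ s(x, z) := by
      intro h
      rcases Sym2.eq_iff.1 h with ⟨h, -⟩ | ⟨h, -⟩
      · exact hxy.ne h.symm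
      · exact hyz.ne h
    have hne2 : s(x, y) ∉ ({s(y, z), s(x, z)} : Finset (Sym2 (Site d))) := by
      simp only [Finset.mem_insert, Finset.mem_singleton, not_or]
      refine ⟨fun h => ?_, fun h => ?_⟩
      · rcases Sym2.eq_iff.1 h with ⟨h, -⟩ | ⟨h, -⟩
        · exact hxy.ne h
        · exact hxz.ne h
      · rcases Sym2.eq_iff.1 h with ⟨-, h⟩ | ⟨h, -⟩
        · exact hyz.ne h
        · exact hxz.ne h
    have hfold : Finset.fold symmDiff (∅ : Finset (Sym2 (Site d))) f {s(x, y), s(y, z), s(x, z)} =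
        symmDiff (f s(x, y)) (symmDiff (f s(y, z)) (f s(x, z))) := by
      rw [Finset.fold_insert hne2, Finset.fold_insert (Finset.notMem_singleton.2 hne1), Finset.fold_singleton,
        ← Finset.bot_eq_empty, symmDiff_bot]
    rw [hfold, hfmk, hfmk, hfmk, symmDiff_pairs_three]
    by_cases hdist : π x ≠ π y ∧ π y ≠ π z ∧ π x ≠ π z
    · left
      rw [if_pos hdist]
      have hadj : ∀ u v : Site d, (zdStar d).Adj u v → π u ≠ π v → (zdStar d).Adj (π u) (π v) :=
        fun u v huv hne => zdStar_adj.2 ⟨hne, (hπlip u v).trans (zdStar_adj.1 huv).2⟩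
      refine ⟨triangle_mem_starTriangles (hadj x y hxy hdist.1) (hadj y z hyz hdist.2.1) (hadj x z hxz hdist.2.2),
        fun e he w hw => ?_⟩
      rcases mem_triangle_iff.1 he with rfl | rfl | rfl <;>
        rcases Sym2.mem_iff.1 hw with rfl | rfl <;> exact hπV _
    · right; rw [if_neg hdist]
  -- push the triangle decomposition of `Z` (in `ℤ^{d★}`) forward; `Z` itself is fixed
  have hspan := inSpan_fold_symmDiff f htri (generatesCycles_zdStar d Z hedge heven)
  rwa [fold_symmDiff_eq_self f] at hspan
  intro e he
  induction e using Sym2.ind with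
  | h x y =>
    have hx : π x = x := hπid x (hV _ he x (Sym2.mem_mk_left x y))
    have hy : π y = y := hπid y (hV _ he y (Sym2.mem_mk_right x y))
    have hne : x ≠ y := by
      have := hedge _ he
      rw [SimpleGraph.mem_edgeSet] at this
      exact this.ne
    rw [hfmk, hx, hy, if_neg hne]

/-- The `V`-family of `★`-triangles consists of even sets of `★`-edges with endpoints in `V` (the side conditions of Lemma B.83 for this
family). [cite: FriedliVelenik2017, App. B.15] -/
theorem starTriangles_sub_even_edge {V : Set (Site d)} {T : Finset (Sym2 (Site d))}
    (hT : T ∈ {T | T ∈ starTriangles d ∧ ∀ e ∈ T, ∀ x ∈ e, x ∈ V}) :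
    IsEvenEdgeSet T ∧ ∀ e ∈ T, e ∈ (zdStar d).edgeSet ∧ ∀ x ∈ e, x ∈ V :=
  ⟨isEvenEdgeSet_of_mem_starTriangles hT.1, fun e he =>
    ⟨mem_edgeSet_of_mem_starTriangles hT.1 he, hT.2 e he⟩⟩

/-- **The generation hypothesis of Lemma B.83 for a retract**, in the shape consumed by `exists_generator_crossing_both_rel` (`V` as the
vertex set of the induced `★`-graph). [cite: FriedliVelenik2017, App. B.15, Lemmas B.81, B.83] [cite: Timar2013, Theorem 3] -/
theorem gen_of_retract {V : Set (Site d)} (π : Site d → Site d) (hπV : ∀ x, π x ∈ V)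
    (hπid : ∀ x ∈ V, π x = x) (hπlip : ∀ x y, supDist (π x) (π y) ≤ supDist x y)
    (Z : Finset (Sym2 (Site d))) (hZ : ∀ e ∈ Z, e ∈ (zdStar d).edgeSet ∧ ∀ x ∈ e, x ∈ V) (heven : IsEvenEdgeSet Z) :
    InSpan {T | T ∈ starTriangles d ∧ ∀ e ∈ T, ∀ x ∈ e, x ∈ V} Z :=
  inSpan_starTriangles_of_retract π hπV hπid hπlip (fun e he => (hZ e he).1) heven fun e he => (hZ e he).2

/-! ## §3 Two stock retractions: coordinate clamps and their composition with a `1`-Lipschitz map -/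

/-- **Clamping one coordinate into an interval is `1`-Lipschitz and idempotent**: for `lo ≤ hi`, `t ↦ max lo (min t hi)` satisfies
`|clamp t − clamp t'| ≤ |t − t'|`. [folklore] -/
theorem natAbs_clamp_sub_clamp_le (lo hi t t' : ℤ) :
    (max lo (min t hi) - max lo (min t' hi)).natAbs ≤ (t - t').natAbs := by
  omega

/-- **Clamping into MOVING intervals**: `|clamp_{[lo, M]} t − clamp_{[lo, M']} t'| ≤ max |t − t'| |M − M'|` — the estimate behind the
retraction onto a staircase region whose profile has unit jumps. [folklore] -/
theorem natAbs_clamp_sub_clamp_le_max (lo M M' t t' : ℤ) :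
    (max lo (min t M) - max lo (min t' M')).natAbs ≤ max (t - t').natAbs (M - M').natAbs := by
  rcases le_total (t - t').natAbs (M - M').natAbs with h | h
  · rw [max_eq_right h]; omega
  · rw [max_eq_left h]; omega

end StarRetract

end Summit.CriticalPhenomena.PercolationContinuityZ3.Theorems.Transplant
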